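import Summits.BirchSwinnertonDyer.BirchSwinnertonDyer.Theorems.KolyvaginDepthDoorDepthTableKuriharaSupersingular3967a1
import Summits.BirchSwinnertonDyer.BirchSwinnertonDyer.Theorems.KolyvaginDepthDoorDepthTableKuriharaRankPinInt
import HarnessLib

/-!
# Route `KolyvaginDepthDoor`, crux `KolyvaginDepthSupplyKN` (stmt-BirchSwinnertonDyer-22820) —
# DEPTH TABLE v26 «THE RECORD PINS THE RANK», rank-two curve `3967a1` @ `p = 5`: the depth-two unit record
# `(p, n) = (5, 11111 = 41·271)` + the row's OWN kernel localisation matrix ⟹ `rank_ℤ E(ℚ) = 2` EXACTLY ∧ `Ш(E/ℚ)[5] = 0`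

Helper file of the lead prover of line `levelone` (kdd-p1 g30; `--supports stmt-BirchSwinnertonDyer-22820 --as helper`);
it closes nothing and BSD is NOT proved by it.

The landed row `KolyvaginDepthDoorDepthTableKuriharaSupersingular3967a1` reads the CLAIM of the tree record of `3967a1` @ `(5, 11111)` ONE WAY as
«`Ш(E)[5] = 0`» (Kim Thm. 1.11 at a good SUPERSINGULAR prime), feeding Kim's depth hypothesis `ν(n) ≤ rank` with `2 ≤ rank`
from a Rank2Observatory kernel certificate, and SEPARATELY certifies in the kernel that the localisation matrix of its two
rational points at `(41, 271)` is invertible mod `5` (`C3967a1.localizationInvertible_5_11111`, until now the decorative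
«agreement side»). v26 (`…KuriharaRankPin`, `…KuriharaRankPinInt`) makes that matrix LOAD-BEARING: it gives `2 ≤ rank_ℤ E(ℚ)` by
itself (`two_le_mordellWeilRank_of_localWitness`, unconditional), and the unit gives `#Sel_5(E) ≤ 5²`, hence
`rank ≤ 2` and `Ш[5] = 0`. RESULT `C3967a1.rank_eq_two_and_sha_eq_bot_5_of_kuriharaClaim_11111`: the claim ⟹
«`rank_ℤ E(ℚ) = 2` ∧ `Ш(E/ℚ)[5] = 0`» — the RANK is read off the record too (an exact-rank certificate modulo print,
independent of 2-descent; no `Rank2ObservatoryKernelCerts*` theorem enters the proof term). CONDITIONAL on `hKimG`, `hnf`,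
`hMaz` BY NAME and the claim; per curve; instrument row; nothing class-wide; BSD is NOT proved by any of this.

References: [Kim2022StructureSelmer] Thm. 1.11 (PDF p. 8); [SilvermanAEC2009] VIII.6.7, X.4.2; [CremonaAlgorithms1997] Table 1 (3967a1).
-/

set_option linter.dupNamespace false

noncomputable section

open scoped Classical NumberField

namespace Summit.BirchSwinnertonDyer.BirchSwinnertonDyer.Theorems.KolyvaginDepthDoor

open Literature.NumberTheory.EllipticCurves Literature.NumberTheory.EllipticCurves.ModularForms
  WeierstrassCurve NumberField IsDedekindDomain
open Summit.BirchSwinnertonDyer.BirchSwinnertonDyer.Theorems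

namespace C3967a1

/-- **RANK-TWO CURVE `3967a1` @ `5`: the CLAIM of its depth-two unit record at `n = 11111 = 41·271` ⟹
`rank_ℤ E(ℚ) = 2` EXACTLY ∧ `Ш(E/ℚ)[5] = 0`** — `rank ≤ 2 ∧ Ш[5] = 0` from the unit (Kim Thm. 1.11 at the good SUPERSINGULAR
prime `5`: `#Sel_5 ≤ 5²`, descent count), `2 ≤ rank` from the row's kernel localisation matrix at `(41, 271)`
(`localizationInvertible_5_11111`, unconditional). No 2-descent, no `2 ≤ rank` input. CONDITIONAL on `hKimG`, `hnf`, `hMaz` BY NAME and the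
claim; per curve; BSD is not proved by it. [cite: Kim2022StructureSelmer, Thm. 1.11 (PDF p. 8)] [cite: SilvermanAEC2009, Thm. VIII.6.7, Thm. X.4.2]
[cite: CremonaAlgorithms1997, Table 1 (3967a1)] -/
theorem rank_eq_two_and_sha_eq_bot_5_of_kuriharaClaim_11111
    (hKimG : Kim2022_card_selmerGroup_le_pow_of_kuriharaNumber_ne_zero_of_hasGoodReduction)
    (hnf : exists_isNewformOf) (hMaz : mazur_not_dvd_maninConstant_of_odd) :
    haveI := isElliptic_c3967a1; haveI := isGloballyMinimal_c3967a1;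
      haveI : NeZero (((⟨1, 0, 0, 2, 3⟩ : WeierstrassCurve ℤ).map (Int.castRingHom ℚ)).conductorNorm ℤ) := neZero_conductorNorm_of_isElliptic _;
      haveI := Fact.mk (by norm_num : Nat.Prime 5);
    (∀ (D : ModularParametrizationData ((⟨1, 0, 0, 2, 3⟩ : WeierstrassCurve ℤ).map (Int.castRingHom ℚ)) (((⟨1, 0, 0, 2, 3⟩ : WeierstrassCurve ℤ).map (Int.castRingHom ℚ)).conductorNorm ℤ)), ¬ ((5 : ℕ) : ℤ) ∣ D.maninConstant →
        (∃ u : ℚ, ‖(u : ℚ_[5])‖ = 1 ∧ ((⟨1, 0, 0, 2, 3⟩ : WeierstrassCurve ℤ).map (Int.castRingHom ℚ)).realPeriodRat = u * plusPeriod D.f) →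
        ∃ ψ : (q : ℕ) → (ZMod q)ˣ →* Multiplicative (ZMod 5),
          (∀ q ∈ (11111 : ℕ).primeFactors, Function.Surjective (ψ q)) ∧ kuriharaNumber D.f 5 11111 ψ ≠ 0) →
    ((⟨1, 0, 0, 2, 3⟩ : WeierstrassCurve ℤ).map (Int.castRingHom ℚ)).mordellWeilRank = 2 ∧
      (((⟨1, 0, 0, 2, 3⟩ : WeierstrassCurve ℤ).map (Int.castRingHom ℚ)).sha ⊓ AddSubgroup.torsionBy ((⟨1, 0, 0, 2, 3⟩ : WeierstrassCurve ℤ).map (Int.castRingHom ℚ)).galH1 ((5 : ℕ) : ℤ) : AddSubgroup _) = ⊥ := by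
  haveI := isElliptic_c3967a1
  haveI := isGloballyMinimal_c3967a1
  haveI iNZ : NeZero (((⟨1, 0, 0, 2, 3⟩ : WeierstrassCurve ℤ).map (Int.castRingHom ℚ)).conductorNorm ℤ) := neZero_conductorNorm_of_isElliptic _
  haveI := Fact.mk (by norm_num : Nat.Prime 5)
  haveI : NeZero (11111 : ℕ) := ⟨by norm_num⟩
  haveI : Fact (Nat.Prime 41) := ⟨by norm_num⟩
  haveI : Fact (Nat.Prime 271) := ⟨by norm_num⟩
  intro hδ
  have hloc := localizationInvertible_5_11111
  exact rank_eq_two_and_sha_eq_bot_of_kuriharaClaim_of_supersingular_int hKimG hnf hMaz _ 5 (by norm_num)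
    goodSupersingular_5.1 goodSupersingular_5.2 hasSurjectiveModNGaloisRep_5 kodairaNeron_int_5 41 271 11111 (by norm_num) (by norm_num)
    isCyclicKolyvaginLevel_5_11111 _ _ hloc.1 hloc.2.1 hloc.2.2 hδ

end C3967a1

end Summit.BirchSwinnertonDyer.BirchSwinnertonDyer.Theorems.KolyvaginDepthDoor

end
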